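/-
Copyright: statement-level skeleton of a published paper (lit-balaban cell, Phase-2 proof seat p10, gen 4). No proof claims
beyond what the kernel checks below.
-/
import Mathlib
import Literature.MathematicalPhysics.QuantumFieldTheory.BalabanImbrieJaffe1984to88.BIJ85Eq7113Derivation

/-!
# `BalabanImbrieJaffe1984to88.BIJ85Eq7113DerivationPart2` — T. Bałaban, J. Imbrie, A. Jaffe, *Renormalization of the Higgs model:
minimizers, propagators and the stability of mean field theory*, Commun. Math. Phys. **97** (1985) 299–329
[BalabanImbrieJaffe1985]: Sect. 7.1 p. 322 — **the derivation (7.1.12) ⟹ (7.1.13)–(7.1.16) at a fixed fibre p′; file 2/3: the Hodge split and the normal equations**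

statement-level skeleton of published theorems with citation tags; proofs where landed; nothing here is a claim about
the Yang–Mills mass gap

CITATION HEADER (lean-in-tree rule).  Part of the lit-balaban TYPED SKELETON (HOME `run/shared/lean/pub/lit-balaban/`); WHAT IS
REPRODUCED: the derivation member of SKELETON rows **C1.Eq7.1.13-7.1.19** / **C1.Thm7.1.1** of `HOME/lit-balaban-r15/ROWS-C1.md`
(fold owner r15, referee ref-5) — p. 322 [PDF 24]: *"Starting from this expression, one can derive the following formulas for σ_k(p)
by straightforward, algebraic manipulation: We express σ_k as a sum of two terms σ_k = τ₁ + τ₂. (7.1.13)"*.  The setting, the printed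
inputs ((4.2.1), (2.13)–(2.24), [6I] (1.61), (7.1.4)–(7.1.16)), the weight convention note and all DEFINITIONS are in
`BIJ85Eq7113Derivation` (file 1/3 of this derivation); this file has theorems only.

WHAT IS PROVED here (zero `sorry`, standard axioms): two facts about the bracket P = [δ − ∂∂̄/Δ] of (7.1.14) (a row of P against a
vector; ∂̄P = 0), the pointwise Hodge split of an antisymmetric tensor G = ∂ ∧ (Δ⁻¹∂^*G) + (P ⊗ P)G, hence Q^{e*}_kf = ∂B₀ + R at every
shift (`qeStar_eq`) with R ⟂ all curls (`sum_curl_remF`; (7.1.17) *"τ₁ vanishes on curls"*); the one-shift identity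
⟨∂A, ∂B⟩ = Δ⟨A,B⟩ − \overline{d^*A}·d^*B (`sum_curl_curl`, ∂^*∂ + dd^* = Δ on one-forms); the (2.20)-pairing lemmas; and **the normal
equations ⟨∂A, Q^{e*}_kf − ∂A*⟩ = 0 for every A with Q_kA = 0** (`normal_eq`) — ∂A* is the projection ∂G_{k,Ax}∂^*Q^{e*}_kf of p. 311.
File 3/3 `BIJ85Eq7113DerivationPart3` computes the value and concludes (7.1.13).
Unit `lit-balaban-p10` (gen 4), HOME as above.
-/

namespace Literature.MathematicalPhysics.QuantumFieldTheory.BalabanImbrieJaffe1984to88.BIJ85Eq7113DerivationPart2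


open scoped BigOperators Real ComplexConjugate Matrix Kronecker
open Complex Finset Matrix
open Literature.MathematicalPhysics.QuantumFieldTheory.BalabanImbrieJaffe1984to88.BIJ85MomentumSymbols71
open Literature.MathematicalPhysics.QuantumFieldTheory.BalabanImbrieJaffe1984to88.BIJ85CurlComplement719
open Literature.MathematicalPhysics.QuantumFieldTheory.BalabanImbrieJaffe1984to88.BIJ85Tau0Positivity729
open Literature.MathematicalPhysics.QuantumFieldTheory.BalabanImbrieJaffe1984to88.BIJ85Tau2Kernel715
open Literature.MathematicalPhysics.QuantumFieldTheory.BalabanImbrieJaffe1984to88.BIJ85SigmaOnCurls325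
open Literature.MathematicalPhysics.QuantumFieldTheory.BalabanImbrieJaffe1984to88.BIJ85Prop712Fibre
open Literature.MathematicalPhysics.QuantumFieldTheory.BalabanImbrieJaffe1984to88.BIJ85Thm711Fibrewise
open Literature.MathematicalPhysics.QuantumFieldTheory.BalabanImbrieJaffe1984to88.BIJ85SigmaClosedCube
open Literature.MathematicalPhysics.QuantumFieldTheory.BalabanImbrieJaffe1984to88.BIJ85Thm711ClosedCube

open Literature.MathematicalPhysics.QuantumFieldTheory.BalabanImbrieJaffe1984to88.BIJ85Eq7113Derivation

noncomputable section

variable {d : ℕ}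

section Proofs

variable {η : ℝ} {M : ℕ} {p : Fin d → ℝ}

/-! ### two facts about the bracket P = [δ − ∂∂̄/Δ] -/

/-- kernel: a row of P against a vector: Σ_λ P_{μλ} w_λ = w_μ − ∂_μ (Σ_λ ∂̄_λ w_λ)/Δ. [folklore] -/
private theorem projK_row_sum (e w : Fin d → ℂ) (μ : Fin d) :
    ∑ l, projK e μ l * w l = w μ - e μ * (∑ l, conj (e l) * w l) / (((∑ ρ, ‖e ρ‖ ^ 2 : ℝ)) : ℂ) := by
  simp only [projK_apply, sub_mul, Finset.sum_sub_distrib, ite_mul, one_mul, zero_mul, Finset.sum_ite_eq,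
    Finset.mem_univ, if_true]
  congr 1
  rw [Finset.mul_sum, Finset.sum_div]
  exact Finset.sum_congr rfl fun l _ => by ring

/-- kernel: ∂̄ is killed by P: Σ_μ ∂̄_μ P_{μλ} = 0 (Δ ≠ 0). [folklore] -/
private theorem sum_conj_projK {e : Fin d → ℂ} (he : (∑ ρ, ‖e ρ‖ ^ 2) ≠ 0) (l : Fin d) :
    ∑ μ, conj (e μ) * projK e μ l = 0 := by
  have h := congr_fun (projK_mulVec_self he) l
  rw [Pi.zero_apply, Matrix.mulVec, dotProduct] at h
  have h' := congrArg conj h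
  rw [map_sum, map_zero] at h'
  rw [← h']
  exact Finset.sum_congr rfl fun μ _ => by rw [map_mul, projK_conj, mul_comm]

/-- kernel, the pointwise Hodge decomposition of an antisymmetric tensor G against ∂ ≠ 0:
G = ∂ ∧ (Δ⁻¹∂^*G) + (P ⊗ P)G. [folklore] -/
private theorem hodge_point (e : Fin d → ℂ) {G : Fin d → Fin d → ℂ} (hanti : ∀ l κ, G κ l = -G l κ) (μ ν : Fin d) :
    G μ ν = (e μ * (((((∑ ρ, ‖e ρ‖ ^ 2 : ℝ)) : ℂ))⁻¹ * ∑ l, conj (e l) * G l ν) -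
        e ν * (((((∑ ρ, ‖e ρ‖ ^ 2 : ℝ)) : ℂ))⁻¹ * ∑ l, conj (e l) * G l μ)) +
      ∑ l, ∑ κ, projK e μ l * projK e ν κ * G l κ := by
  -- the doubly contracted tensor vanishes by antisymmetry
  have hS : ∑ l, ∑ κ, conj (e l) * conj (e κ) * G l κ = 0 := by
    have h : ∑ l, ∑ κ, conj (e l) * conj (e κ) * G l κ = -(∑ l, ∑ κ, conj (e l) * conj (e κ) * G l κ) := by
      conv_lhs => rw [Finset.sum_comm]
      rw [← Finset.sum_neg_distrib]
      refine Finset.sum_congr rfl fun l _ => ?_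
      rw [← Finset.sum_neg_distrib]
      refine Finset.sum_congr rfl fun κ _ => ?_
      rw [hanti l κ]
      ring
    linear_combination (1 / 2 : ℂ) * h
  have hrow : ∑ κ, conj (e κ) * G μ κ = -∑ κ, conj (e κ) * G κ μ := by
    rw [← Finset.sum_neg_distrib]
    exact Finset.sum_congr rfl fun κ _ => by rw [hanti μ κ]; ring
  have h1 : ∑ l, ∑ κ, projK e μ l * projK e ν κ * G l κ = ∑ l, projK e μ l * ∑ κ, projK e ν κ * G l κ := by
    refine Finset.sum_congr rfl fun l _ => ?_
    rw [Finset.mul_sum]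
    exact Finset.sum_congr rfl fun κ _ => by ring
  have h2 : ∀ l, ∑ κ, projK e ν κ * G l κ =
      G l ν - e ν * (∑ κ, conj (e κ) * G l κ) / (((∑ ρ, ‖e ρ‖ ^ 2 : ℝ)) : ℂ) := fun l => projK_row_sum e (G l) ν
  have h3 : ∑ l, conj (e l) * (G l ν - e ν * (∑ κ, conj (e κ) * G l κ) / (((∑ ρ, ‖e ρ‖ ^ 2 : ℝ)) : ℂ)) =
      ∑ l, conj (e l) * G l ν := by
    have h4 : ∑ l, conj (e l) * (e ν * (∑ κ, conj (e κ) * G l κ) / (((∑ ρ, ‖e ρ‖ ^ 2 : ℝ)) : ℂ)) =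
        e ν / (((∑ ρ, ‖e ρ‖ ^ 2 : ℝ)) : ℂ) * ∑ l, ∑ κ, conj (e l) * conj (e κ) * G l κ := by
      rw [Finset.mul_sum]
      refine Finset.sum_congr rfl fun l _ => ?_
      rw [show (∑ κ, conj (e l) * conj (e κ) * G l κ) = conj (e l) * ∑ κ, conj (e κ) * G l κ from by
        rw [Finset.mul_sum]; exact Finset.sum_congr rfl fun κ _ => by ring]
      ring
    simp only [mul_sub, Finset.sum_sub_distrib, h4, hS, mul_zero, sub_zero]
  rw [h1]
  simp_rw [h2]
  rw [projK_row_sum, h3, hrow]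
  ring

/-- kernel: P ⊗ P is orthogonal to ∂ in the first slot: Σ_μ ∂̄_μ ((P ⊗ P)G)_{μν} = 0. [folklore] -/
private theorem conj_sum_lamP_fst {e : Fin d → ℂ} (he : (∑ ρ, ‖e ρ‖ ^ 2) ≠ 0) (G : Fin d → Fin d → ℂ) (ν : Fin d) :
    ∑ μ, conj (e μ) * ∑ l, ∑ κ, projK e μ l * projK e ν κ * G l κ = 0 := by
  have h1 : ∑ μ, conj (e μ) * ∑ l, ∑ κ, projK e μ l * projK e ν κ * G l κ =
      ∑ μ, ∑ l, ∑ κ, conj (e μ) * projK e μ l * (projK e ν κ * G l κ) := by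
    refine Finset.sum_congr rfl fun μ _ => ?_
    rw [Finset.mul_sum]
    refine Finset.sum_congr rfl fun l _ => ?_
    rw [Finset.mul_sum]
    exact Finset.sum_congr rfl fun κ _ => by ring
  rw [h1, Finset.sum_comm]
  refine Finset.sum_eq_zero fun l _ => ?_
  rw [Finset.sum_comm]
  refine Finset.sum_eq_zero fun κ _ => ?_
  rw [← Finset.sum_mul, sum_conj_projK he, zero_mul]

/-- kernel: P ⊗ P is orthogonal to ∂ in the second slot: Σ_ν ∂̄_ν ((P ⊗ P)G)_{μν} = 0. [folklore] -/
private theorem conj_sum_lamP_snd {e : Fin d → ℂ} (he : (∑ ρ, ‖e ρ‖ ^ 2) ≠ 0) (G : Fin d → Fin d → ℂ) (μ : Fin d) :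
    ∑ ν, conj (e ν) * ∑ l, ∑ κ, projK e μ l * projK e ν κ * G l κ = 0 := by
  have h1 : ∑ ν, conj (e ν) * ∑ l, ∑ κ, projK e μ l * projK e ν κ * G l κ =
      ∑ ν, ∑ l, ∑ κ, conj (e ν) * projK e ν κ * (projK e μ l * G l κ) := by
    refine Finset.sum_congr rfl fun ν _ => ?_
    rw [Finset.mul_sum]
    refine Finset.sum_congr rfl fun l _ => ?_
    rw [Finset.mul_sum]
    exact Finset.sum_congr rfl fun κ _ => by ring
  rw [h1, Finset.sum_comm]
  refine Finset.sum_eq_zero fun l _ => ?_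
  rw [Finset.sum_comm]
  refine Finset.sum_eq_zero fun κ _ => ?_
  rw [← Finset.sum_mul, sum_conj_projK he, zero_mul]

/-- kernel: z z̄ = |z|² in ℂ. [folklore] -/
private theorem mul_conj_eq (z : ℂ) : z * conj z = ((‖z‖ ^ 2 : ℝ) : ℂ) := by
  rw [Complex.mul_conj, Complex.normSq_eq_norm_sq]

/-- kernel: |x + y|² = |x|² + |y|² + 2Re(x̄y) in ℂ. [folklore] -/
private theorem norm_add_sq_complex (x y : ℂ) : ‖x + y‖ ^ 2 = ‖x‖ ^ 2 + ‖y‖ ^ 2 + 2 * (conj x * y).re := by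
  apply Complex.ofReal_injective
  rw [Complex.ofReal_add, Complex.ofReal_add, ← mul_conj_eq, ← mul_conj_eq, ← mul_conj_eq, ← Complex.add_conj]
  simp only [map_add, map_mul, Complex.conj_conj]
  ring

/-! ### the plaquette pairing -/

/-- ‖X + Y‖² = ‖X‖² + ‖Y‖² + 2Re⟨X, Y⟩ for the pairing (2.20). [folklore] [cite: BalabanImbrieJaffe1985, (2.20) p.305] -/
theorem pNormSq_add (X Y : (Fin d → ℤ) → Fin d → Fin d → ℂ) :
    pNormSq M (fun m μ ν => X m μ ν + Y m μ ν) = pNormSq M X + pNormSq M Y + 2 * (pInner M X Y).re := by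
  unfold pNormSq pInner
  simp only [norm_add_sq_complex, Finset.sum_add_distrib, Complex.mul_re, Complex.re_sum, ← Finset.mul_sum]
  norm_num
  ring

/-- ⟨X, −Y⟩ = −⟨X, Y⟩ for the pairing (2.20). [folklore] [cite: BalabanImbrieJaffe1985, (2.20) p.305] -/
theorem pInner_neg_right (X Y : (Fin d → ℤ) → Fin d → Fin d → ℂ) :
    pInner M X (fun m μ ν => -Y m μ ν) = -pInner M X Y := by
  unfold pInner
  simp only [mul_neg, Finset.sum_neg_distrib]

/-- 0 ≤ ‖X‖² for (2.20). [folklore] [cite: BalabanImbrieJaffe1985, (2.20) p.305] -/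
theorem pNormSq_nonneg (X : (Fin d → ℤ) → Fin d → Fin d → ℂ) : 0 ≤ pNormSq M X := by
  unfold pNormSq
  positivity

/-! ### the curl calculus at one shift -/

/-- The curl of a gauge mode ∂λ vanishes. [cite: BalabanImbrieJaffe1985, (7.1.4) p.322] -/
theorem curlF_gauge (lam : (Fin d → ℤ) → ℂ) (m : Fin d → ℤ) (μ ν : Fin d) :
    curlF η p (fun m ν => dSym η (shiftMom p m) ν * lam m) m μ ν = 0 := by
  unfold curlF; ring

/-- The curl is additive. [cite: BalabanImbrieJaffe1985, (7.1.4) p.322] -/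
theorem curlF_sub (A B : (Fin d → ℤ) → Fin d → ℂ) (m : Fin d → ℤ) (μ ν : Fin d) :
    curlF η p (fun m μ => A m μ - B m μ) m μ ν = curlF η p A m μ ν - curlF η p B m μ ν := by
  unfold curlF; ring

/-- Σ_{μν}\overline{(∂A)_{μν}}(∂B)_{μν} = 2(Δ⟨A,B⟩ − \overline{d^*A}·d^*B) at one shift: ∂^*∂ + dd^* = Δ of (7.1.6) on one-forms.
[cite: BalabanImbrieJaffe1985, (7.1.6) p.322] -/
theorem sum_curl_curl (A B : (Fin d → ℤ) → Fin d → ℂ) (m : Fin d → ℤ) :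
    ∑ μ, ∑ ν, conj (curlF η p A m μ ν) * curlF η p B m μ ν =
      2 * ((lapSym η (shiftMom p m) : ℂ) * ∑ ν, conj (A m ν) * B m ν - conj (divF η p A m) * divF η p B m) := by
  rw [lapSym_eq_sum_conj_mul]
  unfold curlF divF
  have hsplit : ∀ μ ν, conj (dSym η (shiftMom p m) μ * A m ν - dSym η (shiftMom p m) ν * A m μ) *
      (dSym η (shiftMom p m) μ * B m ν - dSym η (shiftMom p m) ν * B m μ) =
      (conj (dSym η (shiftMom p m) μ) * dSym η (shiftMom p m) μ) * (conj (A m ν) * B m ν) +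
      (conj (dSym η (shiftMom p m) ν) * dSym η (shiftMom p m) ν) * (conj (A m μ) * B m μ) -
      (dSym η (shiftMom p m) μ * conj (A m μ)) * (conj (dSym η (shiftMom p m) ν) * B m ν) -
      (dSym η (shiftMom p m) ν * conj (A m ν)) * (conj (dSym η (shiftMom p m) μ) * B m μ) := by
    intro μ ν
    simp only [map_sub, map_mul]
    ring
  simp_rw [hsplit]
  simp only [Finset.sum_sub_distrib, Finset.sum_add_distrib]
  rw [← Finset.sum_mul_sum, ← Finset.sum_mul_sum]
  have h2 : ∑ μ, ∑ ν, (conj (dSym η (shiftMom p m) ν) * dSym η (shiftMom p m) ν) * (conj (A m μ) * B m μ) =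
      (∑ ν, conj (dSym η (shiftMom p m) ν) * dSym η (shiftMom p m) ν) * ∑ μ, conj (A m μ) * B m μ := by
    rw [Finset.sum_mul_sum]; exact Finset.sum_comm
  have h4 : ∑ μ, ∑ ν, (dSym η (shiftMom p m) ν * conj (A m ν)) * (conj (dSym η (shiftMom p m) μ) * B m μ) =
      (∑ ν, dSym η (shiftMom p m) ν * conj (A m ν)) * ∑ μ, conj (dSym η (shiftMom p m) μ) * B m μ := by
    rw [Finset.sum_mul_sum]; exact Finset.sum_comm
  rw [h2, h4, map_sum]
  simp only [map_mul, Complex.conj_conj]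
  ring

/-- The pointwise Hodge split Q^{e*}_kf = ∂B₀ + R at every shift, for antisymmetric f ((7.1.17): I = P_∂ + (I − P_∂) fibrewise).
[cite: BalabanImbrieJaffe1985, (7.1.17) p.323] -/
theorem qeStar_eq {f : Fin d → Fin d → ℂ} (hf : IsTwoForm f) (m : Fin d → ℤ) (μ ν : Fin d) :
    qeStar η p f m μ ν = curlF η p (bZero η p f) m μ ν + remF η p f m μ ν := by
  have hanti : ∀ l κ, qeStar η p f m κ l = -qeStar η p f m l κ := by
    intro l κ; unfold qeStar wE; rw [hf l κ]; ring
  refine (hodge_point (dSym η (shiftMom p m)) hanti μ ν).trans ?_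
  unfold curlF bZero coD remF
  rw [show ((∑ ρ, ‖dSym η (shiftMom p m) ρ‖ ^ 2 : ℝ)) = lapSym η (shiftMom p m) from rfl]
  push_cast
  ring

/-- R ⟂ curls, first slot: Σ_μ\bar{∂}_μR_{μν} = 0 (*"the expressions inside brackets [ ] are projection operators"*). [cite: BalabanImbrieJaffe1985, (7.1.14) p.322] -/
theorem coD_remF (hG : Generic η M p) (f : Fin d → Fin d → ℂ) {m : Fin d → ℤ} (hm : m ∈ lShifts d M) (ν : Fin d) :
    ∑ μ, conj (dSym η (shiftMom p m) μ) * remF η p f m μ ν = 0 := by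
  unfold remF
  exact conj_sum_lamP_fst (hG.lap_ne m hm) _ ν

/-- R ⟂ curls, second slot: Σ_ν\bar{∂}_νR_{μν} = 0. [cite: BalabanImbrieJaffe1985, (7.1.14) p.322] -/
theorem coD_remF' (hG : Generic η M p) (f : Fin d → Fin d → ℂ) {m : Fin d → ℤ} (hm : m ∈ lShifts d M) (μ : Fin d) :
    ∑ ν, conj (dSym η (shiftMom p m) ν) * remF η p f m μ ν = 0 := by
  unfold remF
  exact conj_sum_lamP_snd (hG.lap_ne m hm) _ μ

/-- Hence Σ_{μν}\overline{(∂A)_{μν}}R_{μν} = 0 at every shift, for every A (*"τ₁ vanishes on curls"*). [cite: BalabanImbrieJaffe1985, (7.1.17) p.323] -/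
theorem sum_curl_remF (hG : Generic η M p) (f : Fin d → Fin d → ℂ) (A : (Fin d → ℤ) → Fin d → ℂ) {m : Fin d → ℤ}
    (hm : m ∈ lShifts d M) : ∑ μ, ∑ ν, conj (curlF η p A m μ ν) * remF η p f m μ ν = 0 := by
  have hR1 := fun ν => coD_remF hG f hm ν
  have hR2 := fun μ => coD_remF' hG f hm μ
  unfold curlF
  simp only [map_sub, map_mul, sub_mul, Finset.sum_sub_distrib]
  have h1 : ∑ μ, ∑ ν, conj (dSym η (shiftMom p m) μ) * conj (A m ν) * remF η p f m μ ν = 0 := by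
    rw [Finset.sum_comm]
    refine Finset.sum_eq_zero fun ν _ => ?_
    rw [show ∑ μ, conj (dSym η (shiftMom p m) μ) * conj (A m ν) * remF η p f m μ ν =
        conj (A m ν) * ∑ μ, conj (dSym η (shiftMom p m) μ) * remF η p f m μ ν from by
      rw [Finset.mul_sum]; exact Finset.sum_congr rfl fun μ _ => by ring, hR1 ν, mul_zero]
  have h2 : ∑ μ, ∑ ν, conj (dSym η (shiftMom p m) ν) * conj (A m μ) * remF η p f m μ ν = 0 := by
    refine Finset.sum_eq_zero fun μ _ => ?_
    rw [show ∑ ν, conj (dSym η (shiftMom p m) ν) * conj (A m μ) * remF η p f m μ ν =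
        conj (A m μ) * ∑ ν, conj (dSym η (shiftMom p m) ν) * remF η p f m μ ν from by
      rw [Finset.mul_sum]; exact Finset.sum_congr rfl fun ν _ => by ring, hR2 μ, mul_zero]
  rw [h1, h2, sub_zero]

/-! ### the normal equations and the value -/

/-- **The normal equations**: ⟨∂A, Q^{e*}_kf − ∂A*⟩ = 0 for every A with Q_kA = 0 — so ∂A* is the orthogonal projection
∂G_{k,Ax}∂^*(Q^{e*}_kf) of p. 311. [cite: BalabanImbrieJaffe1985, (7.1.12) p.322] -/
theorem normal_eq (hG : Generic η M p) {f : Fin d → Fin d → ℂ} (hf : IsTwoForm f) {A : (Fin d → ℤ) → Fin d → ℂ}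
    (hA : ∀ ν, qOp η M p A ν = 0) :
    pInner M (curlF η p A) (fun m μ ν => qeStar η p f m μ ν - curlF η p (minimiser η M p f) m μ ν) = 0 := by
  have hpt : ∀ m ∈ lShifts d M, ∀ μ ν, qeStar η p f m μ ν - curlF η p (minimiser η M p f) m μ ν =
      remF η p f m μ ν + curlF η p (aOne η M p f) m μ ν := by
    intro m hm μ ν
    rw [qeStar_eq (η := η) (p := p) hf m μ ν]
    unfold curlF minimiser
    ring
  have hm_term : ∀ m ∈ lShifts d M,
      ∑ μ, ∑ ν, conj (curlF η p A m μ ν) * (qeStar η p f m μ ν - curlF η p (minimiser η M p f) m μ ν) =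
        ∑ ν, 2 * (conj (rQ η p m ν * A m ν) * cVec η M p f ν) := by
    intro m hm
    have hL : ((lapSym η (shiftMom p m) : ℝ) : ℂ) ≠ 0 := Complex.ofReal_ne_zero.mpr (hG.lap_ne m hm)
    rw [show (∑ μ, ∑ ν, conj (curlF η p A m μ ν) * (qeStar η p f m μ ν - curlF η p (minimiser η M p f) m μ ν)) =
        ∑ μ, ∑ ν, (conj (curlF η p A m μ ν) * remF η p f m μ ν +
          conj (curlF η p A m μ ν) * curlF η p (aOne η M p f) m μ ν) from
      Finset.sum_congr rfl fun μ _ => Finset.sum_congr rfl fun ν _ => by rw [hpt m hm μ ν, mul_add]]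
    simp only [Finset.sum_add_distrib]
    rw [sum_curl_remF hG f A hm, zero_add, sum_curl_curl, divF_aOne hG f hm, mul_zero, sub_zero, Finset.mul_sum,
      Finset.mul_sum]
    refine Finset.sum_congr rfl fun ν _ => ?_
    unfold aOne
    simp only [map_mul]
    push_cast
    field_simp
  unfold pInner
  rw [Finset.sum_congr rfl hm_term, Finset.sum_comm]
  have hν : ∀ ν, ∑ m ∈ lShifts d M, 2 * (conj (rQ η p m ν * A m ν) * cVec η M p f ν) =
      2 * (conj (qOp η M p A ν) * cVec η M p f ν) := by
    intro ν
    rw [qOp, map_sum, Finset.sum_mul, Finset.mul_sum]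
  simp_rw [hν, hA, map_zero, zero_mul, mul_zero, Finset.sum_const_zero, mul_zero]

end Proofs

end

end Literature.MathematicalPhysics.QuantumFieldTheory.BalabanImbrieJaffe1984to88.BIJ85Eq7113DerivationPart2
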